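import Literature.AnabelianGeometry.SemiGraphs.FiniteEtaleCoveringCompPiecesSlice
import Literature.AnabelianGeometry.SemiGraphs.FiniteEtaleCoveringCompGluing
import Literature.AnabelianGeometry.SemiGraphs.FiniteEtaleCoveringCompLocal

/-!
# The LOCAL clause of a composite of finite étale coverings, from the tie ([SemiAnbd] Def. 2.2 (i),
# p. 23; Rmk. 2.4.1, p. 26)

Mochizuki, *Semi-graphs of anabelioids*, Publ. RIMS **42** (2006) 221–322, §2, Def. 2.2 (i) and the
paragraph before it, author's manuscript p. 23, and Remark 2.4.1 p. 26 (whose universally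
sub-coverticial clause uses that finite étale coverings compose) [cite: MochizukiSemiAnbd2006, Def. 2.2(i) p.23].

PROOF-ONLY (abc-iut cell, layer L3; FACT-LIST row F-1478 `remark_2_4_1_covering`, residual (L) «the LOCAL
clause of a composite of print's coverings», Route W assembly (L-S)/(L-B)/(L-A) of
`HOME/staging/w5/w5-d041-g3/L-LOCAL-CLAUSE-DECOMPOSITION.md`; seat abc-iut-w5-d041).  For `φ : 𝒢 → ℋ` locally the
covering attached to `αψ X` and `ψ : ℋ → 𝒦` with a global witness `(αψ, e_ψ)` over `A` and local witnesses
(vertex data `cV, αV, eV`; edge data `cE, αE, eE` indexed by presentations `ψ e′ = f₀` as in `Hom.φE`),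
the composite `φ.comp ψ` is, locally, the covering attached to `X.left ∈ B(𝒦)` — PROVIDED the section
maps of the vertex / edge comparisons are monomorphisms (abc-iut-w4-d079 `localGlobalSection_mono`,
`sectionMapE_mono`; the branch section needs no hypothesis) and the vertex/edge
section maps factor through components `O w`, `OE e′` with `w ↦ (ψ w, O w)`, `e′ ↦ (ψ e′, OE e′)` bijective
(the «tie», abc-iut-f-161 `Hom.tie_bijective`):

* `Hom.IsFiniteEtaleCoveringOf.comp_of_tie`.

Labels: abc-iut-L3-t1's `componentIn` inside the section-map pieces `K_w X ≅ P_w ×_{σ_w} X_u`,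
`K_{e′} X ≅ Q ×_{σ_{e′}} X_e` (`FiniteEtaleCoveringCompPieces`); constituents: `exists_equiv_comp_star_componentIn`;
bijectivity: `sigma_componentIn_piece_bijective`; branches: L3-t1's abstract step `componentIn_branch` fed
with `compGluing_pieces` (`FiniteEtaleCoveringCompGluing`).  No `def`, no new `Prop`; nothing here takes a
side on [IUTchIII] Cor. 3.12; typed ≠ proved for F-1478 (the tie and the monos are INPUTS here).
-/

namespace Literature.AnabelianGeometry.SemiGraphs

namespace SemiGraphOfAnabelioids

open CategoryTheory CategoryTheory.Limits CategoryTheory.PreGaloisCategory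
open Literature.AnabelianGeometry.Anabelioids

universe v₁ u₁ u

-- Mathlib's `Over.pullback` / `Over.post` simp lemmas only fire under the pre-v4.2x defeq transparency
-- behaviour, exactly as in `Mathlib/CategoryTheory/Comma/Over/Pullback.lean` (also: `π₀Obj` coercions).
set_option backward.isDefEq.respectTransparency false

variable {𝒢 ℋ 𝒦 : SemiGraphOfAnabelioids.{v₁, u₁, u}}

/-- `Hom.compGluing_pieces` with the edge identification abstracted into a variable `ι` fixed by an
equation (bookkeeping for presentation-indexed families). [cite: MochizukiSemiAnbd2006, Def. 2.2(i) p.23] -/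
theorem Hom.compGluing_pieces' (ψ : Hom ℋ 𝒦) (A : 𝒦.BObj) [HasBinaryProducts 𝒦.BObj]
    (αψ : Over A ⥤ ℋ.BObj) [αψ.IsEquivalence] (eψ : ψ.pullbackFunctor ≅ Over.star A ⋙ αψ)
    (b' : ℋ.graph.Branch) (w : ℋ.graph.Vertex) (h' : ℋ.graph.abuts b' = some w)
    (P : 𝒦.V (ψ.base.vertexMap w)) (αw : Over P ⥤ ℋ.V w) [αw.IsEquivalence]
    (ew : (ψ.φV w).pullback ≅ Over.star P ⋙ αw)
    (Q : 𝒦.E (𝒦.graph.edgeOf (ψ.base.branchMap b')))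
    (αf : Over Q ⥤ ℋ.E (ℋ.graph.edgeOf b')) [αf.IsEquivalence]
    (ef : (ψ.φE (ℋ.graph.edgeOf b') (𝒦.graph.edgeOf (ψ.base.branchMap b'))
      (ψ.base.edgeOf_branchMap b').symm).pullback ≅ Over.star Q ⋙ αf)
    (ι : Over.star A ⋙ (αψ ⋙ ℋ.ρE (ℋ.graph.edgeOf b') ⋙ αf.inv) ≅
      𝒦.ρE (𝒦.graph.edgeOf (ψ.base.branchMap b')) ⋙ Over.star Q)
    (hι : ι = Functor.isoWhiskerRight eψ.symm (ℋ.ρE (ℋ.graph.edgeOf b') ⋙ αf.inv) ≪≫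
        Functor.isoWhiskerRight (ψ.reindexIso (ℋ.graph.edgeOf b') (ψ.base.edgeMap (ℋ.graph.edgeOf b'))
          (𝒦.graph.edgeOf (ψ.base.branchMap b')) rfl (ψ.base.edgeOf_branchMap b').symm) αf.inv ≪≫
        Functor.isoWhiskerLeft (𝒦.ρE (𝒦.graph.edgeOf (ψ.base.branchMap b')))
          (Functor.isoWhiskerRight ef αf.inv) ≪≫
        Functor.isoWhiskerLeft (𝒦.ρE (𝒦.graph.edgeOf (ψ.base.branchMap b')) ⋙ Over.star Q)
          αf.asEquivalence.unitIso.symm)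
    (X : Over A) (hT : IsTerminal ((αψ ⋙ ℋ.ρE (ℋ.graph.edgeOf b') ⋙ αf.inv).obj (Over.mk (𝟙 A))))
    (εV : (Hom.localGlobalFunctor ψ A αψ w P αw).obj X ≅
      OverStar.pullbackObj (Hom.localGlobalSection ψ A αψ w P αw eψ ew) (X.hom.fS (ψ.base.vertexMap w)))
    (hεV : εV.hom ≫ OverStar.pullbackι (Over.forgetAdjStar P) (Hom.localGlobalSection ψ A αψ w P αw eψ ew)
        (X.hom.fS (ψ.base.vertexMap w)) =
      (Hom.localGlobalFunctor ψ A αψ w P αw).map (OverStar.unit' (Over.forgetAdjStar A) X) ≫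
        OverStar.ιHom (Hom.localGlobalFunctor ψ A αψ w P αw) (𝒦.ρ (ψ.base.vertexMap w))
          (Hom.localGlobalIso ψ A αψ w P αw eψ ew) X.left)
    (εB : (Hom.branchLocalFunctor ψ b' w h' P αw Q αf).obj ((Hom.localGlobalFunctor ψ A αψ w P αw).obj X) ≅
      OverStar.pullbackObj (Hom.branchSection ψ b' w h' P αw Q αf ew ef)
        ((𝒦.pull (ψ.base.branchMap b') (ψ.base.vertexMap w) (ψ.base.abuts_branchMap b' w h')).pullback.map
          ((Hom.localGlobalFunctor ψ A αψ w P αw).obj X).hom))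
    (hεB : εB.hom ≫ OverStar.pullbackι (Over.forgetAdjStar Q) (Hom.branchSection ψ b' w h' P αw Q αf ew ef)
        ((𝒦.pull (ψ.base.branchMap b') (ψ.base.vertexMap w) (ψ.base.abuts_branchMap b' w h')).pullback.map
          ((Hom.localGlobalFunctor ψ A αψ w P αw).obj X).hom) =
      (Hom.branchLocalFunctor ψ b' w h' P αw Q αf).map
          (OverStar.unit' (Over.forgetAdjStar P) ((Hom.localGlobalFunctor ψ A αψ w P αw).obj X)) ≫
        OverStar.ιHom (Hom.branchLocalFunctor ψ b' w h' P αw Q αf)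
          (𝒦.pull (ψ.base.branchMap b') (ψ.base.vertexMap w) (ψ.base.abuts_branchMap b' w h')).pullback
          (Hom.branchLocalIso ψ b' w h' P αw Q αf ew ef) ((Hom.localGlobalFunctor ψ A αψ w P αw).obj X).left)
    (εE : (αψ ⋙ ℋ.ρE (ℋ.graph.edgeOf b') ⋙ αf.inv).obj X ≅
      OverStar.pullbackObj
        (OverStar.sectionMap (Over.forgetAdjStar A) (Over.forgetAdjStar Q)
          (αψ ⋙ ℋ.ρE (ℋ.graph.edgeOf b') ⋙ αf.inv) (𝒦.ρE (𝒦.graph.edgeOf (ψ.base.branchMap b'))) ι hT)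
        (X.hom.fT (𝒦.graph.edgeOf (ψ.base.branchMap b'))))
    (hεE : εE.hom ≫ OverStar.pullbackι (Over.forgetAdjStar Q)
        (OverStar.sectionMap (Over.forgetAdjStar A) (Over.forgetAdjStar Q)
          (αψ ⋙ ℋ.ρE (ℋ.graph.edgeOf b') ⋙ αf.inv) (𝒦.ρE (𝒦.graph.edgeOf (ψ.base.branchMap b'))) ι hT)
        (X.hom.fT (𝒦.graph.edgeOf (ψ.base.branchMap b'))) =
      (αψ ⋙ ℋ.ρE (ℋ.graph.edgeOf b') ⋙ αf.inv).map (OverStar.unit' (Over.forgetAdjStar A) X) ≫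
        OverStar.ιHom (αψ ⋙ ℋ.ρE (ℋ.graph.edgeOf b') ⋙ αf.inv) (𝒦.ρE (𝒦.graph.edgeOf (ψ.base.branchMap b')))
          ι X.left) :
    (αf.inv.map ((ℋ.pull b' w h').pullback.map
          (αw.asEquivalence.counitIso.hom.app ((αψ.obj X).S w)) ≫ ((αψ.obj X).ψ b' w h').hom)).left ≫
        εE.hom.left ≫ pullback.snd _ _ =
      (εB.hom.left ≫ pullback.snd _ _) ≫
        (𝒦.pull (ψ.base.branchMap b') (ψ.base.vertexMap w) (ψ.base.abuts_branchMap b' w h')).pullback.map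
          (εV.hom.left ≫ pullback.snd _ _) ≫
        (X.left.ψ (ψ.base.branchMap b') (ψ.base.vertexMap w) (ψ.base.abuts_branchMap b' w h')).hom := by
  subst hι
  exact Hom.compGluing_pieces ψ A αψ eψ b' w h' P αw ew Q αf ef X hT εV hεV εB hεB εE hεE

/-- **[SemiAnbd] Def. 2.2 (i) under composition (Rmk. 2.4.1/2.4.2), LOCAL clause, from the tie.**
See the module docstring; all comparison data are explicit, the identifications `ιE` of the edge
comparisons are abc-iut-w4-d079's (`EdgeSectionBasePoint`), fixed by `hιE`.
[cite: MochizukiSemiAnbd2006, Def. 2.2(i) p.23] -/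
theorem Hom.IsFiniteEtaleCoveringOf.comp_of_tie {φ : Hom 𝒢 ℋ} {ψ : Hom ℋ 𝒦} {A : 𝒦.BObj}
    [HasBinaryProducts 𝒦.BObj] (αψ : Over A ⥤ ℋ.BObj) [αψ.IsEquivalence]
    (eψ : ψ.pullbackFunctor ≅ Over.star A ⋙ αψ) (X : Over A) (hψp : SemiGraph.IsProper ψ.base)
    -- vertex data of `ψ`
    (cV : ∀ w : ℋ.graph.Vertex, π₀Obj (A.S (ψ.base.vertexMap w)))
    (αV : ∀ w, Over ((cV w).1 : 𝒦.V (ψ.base.vertexMap w)) ⥤ ℋ.V w) [∀ w, (αV w).IsEquivalence]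
    (eV : ∀ w, (ψ.φV w).pullback ≅ Over.star ((cV w).1 : 𝒦.V (ψ.base.vertexMap w)) ⋙ αV w)
    -- edge data of `ψ`, indexed by presentations of the image edge
    (cE : ∀ (e' : ℋ.graph.Edge) (f₀ : 𝒦.graph.Edge), ψ.base.edgeMap e' = f₀ → π₀Obj (A.T f₀))
    (αE : ∀ e' f₀ p, Over ((cE e' f₀ p).1 : 𝒦.E f₀) ⥤ ℋ.E e') [∀ e' f₀ p, (αE e' f₀ p).IsEquivalence]
    (eE : ∀ e' f₀ p, (ψ.φE e' f₀ p).pullback ≅ Over.star ((cE e' f₀ p).1 : 𝒦.E f₀) ⋙ αE e' f₀ p)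
    (hT : ∀ e' f₀ p, IsTerminal ((αψ ⋙ ℋ.ρE e' ⋙ (αE e' f₀ p).inv).obj (Over.mk (𝟙 A))))
    (ιE : ∀ e' f₀ p, Over.star A ⋙ (αψ ⋙ ℋ.ρE e' ⋙ (αE e' f₀ p).inv) ≅
      𝒦.ρE f₀ ⋙ Over.star ((cE e' f₀ p).1 : 𝒦.E f₀))
    (hιE : ∀ e' f₀ p, ιE e' f₀ p =
      Functor.isoWhiskerRight eψ.symm (ℋ.ρE e' ⋙ (αE e' f₀ p).inv) ≪≫
        Functor.isoWhiskerRight (ψ.reindexIso e' (ψ.base.edgeMap e') f₀ rfl p) (αE e' f₀ p).inv ≪≫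
        Functor.isoWhiskerLeft (𝒦.ρE f₀) (Functor.isoWhiskerRight (eE e' f₀ p) (αE e' f₀ p).inv) ≪≫
        Functor.isoWhiskerLeft (𝒦.ρE f₀ ⋙ Over.star ((cE e' f₀ p).1 : 𝒦.E f₀))
          (αE e' f₀ p).asEquivalence.unitIso.symm)
    -- the section maps are monomorphisms
    (hσV : ∀ w, Mono (Hom.localGlobalSection ψ A αψ w _ (αV w) eψ (eV w)))
    (hσE : ∀ e' f₀ p, Mono (OverStar.sectionMap (Over.forgetAdjStar A)
      (Over.forgetAdjStar ((cE e' f₀ p).1 : 𝒦.E f₀)) (αψ ⋙ ℋ.ρE e' ⋙ (αE e' f₀ p).inv) (𝒦.ρE f₀)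
      (ιE e' f₀ p) (hT e' f₀ p)))
    -- the tie
    (O : ∀ w : ℋ.graph.Vertex, π₀Obj (A.S (ψ.base.vertexMap w)))
    (hOτ : ∀ w, ∃ τ : ((cV w).1 : 𝒦.V (ψ.base.vertexMap w)) ⟶ ((O w).1 : 𝒦.V (ψ.base.vertexMap w)),
      τ ≫ (O w).1.arrow = Hom.localGlobalSection ψ A αψ w _ (αV w) eψ (eV w))
    (hO : Function.Bijective (fun w : ℋ.graph.Vertex => (⟨ψ.base.vertexMap w, O w⟩ : Σ u, π₀Obj (A.S u))))
    (OE : ∀ e' : ℋ.graph.Edge, π₀Obj (A.T (ψ.base.edgeMap e')))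
    (hOEτ : ∀ e', ∃ τ : ((cE e' _ rfl).1 : 𝒦.E (ψ.base.edgeMap e')) ⟶ ((OE e').1 : 𝒦.E (ψ.base.edgeMap e')),
      τ ≫ (OE e').1.arrow = OverStar.sectionMap (Over.forgetAdjStar A)
        (Over.forgetAdjStar ((cE e' _ rfl).1 : 𝒦.E (ψ.base.edgeMap e')))
        (αψ ⋙ ℋ.ρE e' ⋙ (αE e' _ rfl).inv) (𝒦.ρE (ψ.base.edgeMap e')) (ιE e' _ rfl) (hT e' _ rfl))
    (hOE : Function.Bijective (fun e' : ℋ.graph.Edge => (⟨ψ.base.edgeMap e', OE e'⟩ : Σ e, π₀Obj (A.T e))))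
    (hφ : φ.IsFiniteEtaleCoveringOf (αψ.obj X)) :
    (φ.comp ψ).IsFiniteEtaleCoveringOf X.left := by
  obtain ⟨hprop, cVφ, cEφ, hVb, hEb, hV, hE, hbr⟩ := hφ
  haveI := hσV
  haveI : ∀ w, PreGaloisCategory.IsConnected ((cV w).1 : 𝒦.V (ψ.base.vertexMap w)) := fun w => (cV w).2
  haveI : ∀ e' f₀ p, PreGaloisCategory.IsConnected ((cE e' f₀ p).1 : 𝒦.E f₀) :=
    fun e' f₀ p => (cE e' f₀ p).2
  -- the VERTEX comparison functors `K_w`, their rigidity isomorphisms and pieces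
  haveI := fun w => Hom.localGlobalFunctor_preservesLimitsOfShape_walkingParallelPair ψ A αψ w
    ((cV w).1 : 𝒦.V (ψ.base.vertexMap w)) (αV w)
  let εV : ∀ w, (Hom.localGlobalFunctor ψ A αψ w _ (αV w)).obj X ≅
      OverStar.pullbackObj (Hom.localGlobalSection ψ A αψ w _ (αV w) eψ (eV w))
        (X.hom.fS (ψ.base.vertexMap w)) := fun w =>
    OverStar.isoPullback (Over.forgetAdjStar A) (Over.forgetAdjStar _)
      (Hom.localGlobalFunctor ψ A αψ w _ (αV w)) (𝒦.ρ (ψ.base.vertexMap w))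
      (Hom.localGlobalIso ψ A αψ w _ (αV w) eψ (eV w)) (Hom.localGlobalFunctor_isTerminal ψ A αψ w _ (αV w)) X
  let jV : ∀ w, (αV w).obj ((Hom.localGlobalFunctor ψ A αψ w _ (αV w)).obj X) ≅ (αψ.obj X).S w :=
    fun w => (αV w).asEquivalence.counitIso.app ((αψ.obj X).S w)
  haveI hmV : ∀ w, Mono ((εV w).hom.left ≫ pullback.snd _ _) :=
    fun w => mono_isoHomLeft_comp_pullbackSnd _ _ _ (εV w)
  -- the EDGE comparison functors `K_{e′}` (presentation-indexed), their rigidity isomorphisms and pieces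
  haveI : ∀ e' f₀ p, PreservesLimitsOfShape WalkingParallelPair (αψ ⋙ ℋ.ρE e' ⋙ (αE e' f₀ p).inv) :=
    fun e' f₀ p => by
      obtain ⟨-, -, hρE⟩ := ℋ.hasLimitsOfShape_bObj (J := WalkingParallelPair)
      haveI := hρE e'
      infer_instance
  let εE : ∀ e' f₀ p, (αψ ⋙ ℋ.ρE e' ⋙ (αE e' f₀ p).inv).obj X ≅
      OverStar.pullbackObj (OverStar.sectionMap (Over.forgetAdjStar A)
        (Over.forgetAdjStar ((cE e' f₀ p).1 : 𝒦.E f₀)) (αψ ⋙ ℋ.ρE e' ⋙ (αE e' f₀ p).inv) (𝒦.ρE f₀)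
        (ιE e' f₀ p) (hT e' f₀ p)) (X.hom.fT f₀) := fun e' f₀ p =>
    OverStar.isoPullback (Over.forgetAdjStar A) (Over.forgetAdjStar _)
      (αψ ⋙ ℋ.ρE e' ⋙ (αE e' f₀ p).inv) (𝒦.ρE f₀) (ιE e' f₀ p) (hT e' f₀ p) X
  let jE : ∀ e' f₀ p, (αE e' f₀ p).obj ((αψ ⋙ ℋ.ρE e' ⋙ (αE e' f₀ p).inv).obj X) ≅ (αψ.obj X).T e' :=
    fun e' f₀ p => (αE e' f₀ p).asEquivalence.counitIso.app ((αψ.obj X).T e')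
  haveI hmE : ∀ e' f₀ p, Mono ((εE e' f₀ p).hom.left ≫ pullback.snd _ _) :=
    fun e' f₀ p => @mono_isoHomLeft_comp_pullbackSnd _ _ _ _ _ _ _ _ _ (εE e' f₀ p) (hσE e' f₀ p)
  -- the edge labels at all presentations, and their coherence
  let labE : ∀ (e' : ℋ.graph.Edge) (f₀ : 𝒦.graph.Edge) (p : ψ.base.edgeMap e' = f₀),
      π₀Obj ((αψ.obj X).T e') → π₀Obj (X.left.T f₀) := fun e' f₀ p M =>
    componentIn (αE e' f₀ p) ((αψ ⋙ ℋ.ρE e' ⋙ (αE e' f₀ p).inv).obj X)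
      ((εE e' f₀ p).hom.left ≫ pullback.snd _ _) (componentMapIso (jE e' f₀ p).symm M)
  refine ⟨SemiGraph.IsProper.comp hprop hψp,
    fun v => componentIn (αV (φ.base.vertexMap v)) ((Hom.localGlobalFunctor ψ A αψ _ _ (αV _)).obj X)
      ((εV (φ.base.vertexMap v)).hom.left ≫ pullback.snd _ _)
      (componentMapIso (jV (φ.base.vertexMap v)).symm (cVφ v)),
    fun e => labE (φ.base.edgeMap e) _ rfl (cEφ e), ?_, ?_, ?_, ?_, ?_⟩
  · -- vertices are bijective: `φ`'s labels, transported, then the pieces and the tie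
    exact (sigma_componentIn_piece_bijective (ψ.base.vertexMap) 𝒦.V ℋ.V A.S (fun u => X.left.S u)
      (fun u => X.hom.fS u) (fun w => ((cV w).1 : 𝒦.V (ψ.base.vertexMap w)))
      (fun w => Hom.localGlobalSection ψ A αψ w _ (αV w) eψ (eV w)) αV
      (fun w => (Hom.localGlobalFunctor ψ A αψ w _ (αV w)).obj X) εV O hOτ hO).comp
      ((sigma_componentMapIso_bijective ℋ.V
        (fun w => (αV w).obj ((Hom.localGlobalFunctor ψ A αψ w _ (αV w)).obj X))
        (fun w => (αψ.obj X).S w) jV).comp hVb)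
  · -- edges are bijective
    haveI : ∀ e', Mono (OverStar.sectionMap (Over.forgetAdjStar A)
        (Over.forgetAdjStar ((cE e' _ rfl).1 : 𝒦.E (ψ.base.edgeMap e')))
        (αψ ⋙ ℋ.ρE e' ⋙ (αE e' _ rfl).inv) (𝒦.ρE (ψ.base.edgeMap e')) (ιE e' _ rfl) (hT e' _ rfl)) :=
      fun e' => hσE e' _ rfl
    exact (sigma_componentIn_piece_bijective (ψ.base.edgeMap) 𝒦.E ℋ.E A.T (fun e => X.left.T e)
      (fun e => X.hom.fT e) (fun e' => ((cE e' _ rfl).1 : 𝒦.E (ψ.base.edgeMap e')))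
      (fun e' => OverStar.sectionMap (Over.forgetAdjStar A)
        (Over.forgetAdjStar ((cE e' _ rfl).1 : 𝒦.E (ψ.base.edgeMap e')))
        (αψ ⋙ ℋ.ρE e' ⋙ (αE e' _ rfl).inv) (𝒦.ρE (ψ.base.edgeMap e')) (ιE e' _ rfl) (hT e' _ rfl))
      (fun e' => αE e' _ rfl) (fun e' => (αψ ⋙ ℋ.ρE e' ⋙ (αE e' _ rfl).inv).obj X)
      (fun e' => εE e' _ rfl) OE hOEτ hOE).comp
      ((sigma_componentMapIso_bijective ℋ.E
        (fun e' => (αE e' _ rfl).obj ((αψ ⋙ ℋ.ρE e' ⋙ (αE e' _ rfl).inv).obj X))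
        (fun e' => (αψ.obj X).T e') (fun e' => jE e' _ rfl)).comp hEb)
  · -- vertex constituents
    intro v
    obtain ⟨α', hα', ⟨e'⟩⟩ := hV v
    haveI := hα'
    exact exists_equiv_comp_star_componentIn _ _ (αV (φ.base.vertexMap v)) _ (εV (φ.base.vertexMap v))
      (jV (φ.base.vertexMap v)) (cVφ v) (ψ.φV (φ.base.vertexMap v)).pullback (eV _)
      (φ.φV v).pullback α' e'
  · -- edge constituents
    intro e
    obtain ⟨α', hα', ⟨e'⟩⟩ := hE e
    haveI := hα'
    haveI := hσE (φ.base.edgeMap e) _ rfl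
    exact exists_equiv_comp_star_componentIn _ _ (αE (φ.base.edgeMap e) _ rfl) _ (εE (φ.base.edgeMap e) _ rfl)
      (jE (φ.base.edgeMap e) _ rfl) (cEφ e) (ψ.φE (φ.base.edgeMap e) _ rfl).pullback (eE _ _ _)
      (φ.φE e _ rfl).pullback α' e'
  · -- branches: unpack `φ`'s clause at the home edge of `ℋ`, run L3-t1's abstract branch step with the
    -- gluing compatibility `compGluing_pieces`, and repack at the home edge of `𝒦`
    -- coherence of the edge labels across presentations and along equalities of edges of `ℋ`
    have hco : ∀ {e₁ e₂ : ℋ.graph.Edge} (hf : e₁ = e₂) {f₀ : 𝒦.graph.Edge} (p : ψ.base.edgeMap e₁ = f₀)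
        (M : π₀Obj ((αψ.obj X).T e₂)),
        labE e₁ f₀ p ((αψ.obj X).castT hf M) = X.left.castT (by rw [← p, hf]) (labE e₂ _ rfl M) := by
      intro e₁ e₂ hf f₀ p M; subst hf; subst p; rfl
    intro b v h
    have h' : ℋ.graph.abuts (φ.base.branchMap b) = some (φ.base.vertexMap v) := φ.base.abuts_branchMap b v h
    obtain ⟨t, ht⟩ := hbr b v h
    obtain ⟨t', ht'⟩ := (αψ.obj X).exists_fac_castT_of_transport (φ.base.edgeOf_branchMap b)
      (cEφ (𝒢.graph.edgeOf b)) _ t ht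
    -- the data of the abstract branch step
    let f₀ := 𝒦.graph.edgeOf (ψ.base.branchMap (φ.base.branchMap b))
    let p₀ : ψ.base.edgeMap (ℋ.graph.edgeOf (φ.base.branchMap b)) = f₀ :=
      (ψ.base.edgeOf_branchMap (φ.base.branchMap b)).symm
    let P : 𝒦.V (ψ.base.vertexMap (φ.base.vertexMap v)) := (cV (φ.base.vertexMap v)).1
    let αw := αV (φ.base.vertexMap v)
    let ew := eV (φ.base.vertexMap v)
    let Q : 𝒦.E f₀ := (cE (ℋ.graph.edgeOf (φ.base.branchMap b)) f₀ p₀).1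
    let αf := αE (ℋ.graph.edgeOf (φ.base.branchMap b)) f₀ p₀
    let ef := eE (ℋ.graph.edgeOf (φ.base.branchMap b)) f₀ p₀
    let Lb := Hom.branchLocalFunctor ψ (φ.base.branchMap b) (φ.base.vertexMap v) h' P αw Q αf
    let ιL := Hom.branchLocalIso ψ (φ.base.branchMap b) (φ.base.vertexMap v) h' P αw Q αf ew ef
    let hTL := Hom.branchLocalFunctor_isTerminal ψ (φ.base.branchMap b) (φ.base.vertexMap v) h' P αw Q αf
    haveI := Hom.branchLocalFunctor_preservesLimitsOfShape_walkingParallelPair ψ (φ.base.branchMap b)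
      (φ.base.vertexMap v) h' P αw Q αf
    let pbK := (𝒦.pull (ψ.base.branchMap (φ.base.branchMap b)) (ψ.base.vertexMap (φ.base.vertexMap v))
      (ψ.base.abuts_branchMap _ _ h')).pullback
    let εB := fun U : Over P =>
      OverStar.isoPullback (Over.forgetAdjStar P) (Over.forgetAdjStar Q) Lb pbK ιL hTL U
    let Y : Over P := (Hom.localGlobalFunctor ψ A αψ (φ.base.vertexMap v) P αw).obj X
    let Y' : Over Q := (αψ ⋙ ℋ.ρE (ℋ.graph.edgeOf (φ.base.branchMap b)) ⋙ αf.inv).obj X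
    let γ : Lb.obj Y ≅ Y' := αf.inv.mapIso
      ((ℋ.pull (φ.base.branchMap b) (φ.base.vertexMap v) h').pullback.mapIso (jV (φ.base.vertexMap v)) ≪≫
        (αψ.obj X).ψ (φ.base.branchMap b) (φ.base.vertexMap v) h')
    let K : π₀Obj (αw.obj Y) := componentMapIso (jV (φ.base.vertexMap v)).symm (cVφ v)
    let Lc : π₀Obj ((αψ.obj X).T (ℋ.graph.edgeOf (φ.base.branchMap b))) :=
      (αψ.obj X).castT (φ.base.edgeOf_branchMap b) (cEφ (𝒢.graph.edgeOf b))
    let L : π₀Obj (αf.obj Y') := componentMapIso (jE (ℋ.graph.edgeOf (φ.base.branchMap b)) f₀ p₀).symm Lc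
    let uK : (K.1 : ℋ.V (φ.base.vertexMap v)) ≅ ((cVφ v).1 : ℋ.V (φ.base.vertexMap v)) :=
      Subobject.underlyingIso ((cVφ v).1.arrow ≫ (jV (φ.base.vertexMap v)).symm.hom)
    let uL : (L.1 : ℋ.E (ℋ.graph.edgeOf (φ.base.branchMap b))) ≅ (Lc.1 : ℋ.E _) :=
      Subobject.underlyingIso (Lc.1.arrow ≫ (jE (ℋ.graph.edgeOf (φ.base.branchMap b)) f₀ p₀).symm.hom)
    -- the abstract branch step
    obtain ⟨s, hs⟩ := componentIn_branch αw αf (ℋ.pull (φ.base.branchMap b) (φ.base.vertexMap v) h').pullback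
      Lb ((Functor.isoWhiskerLeft (αw ⋙ (ℋ.pull (φ.base.branchMap b) (φ.base.vertexMap v) h').pullback)
        αf.asEquivalence.counitIso).symm) pbK
      (fun U => (εB U).hom.left ≫ pullback.snd _ _)
      (fun {U U'} g => by
        have hn := congrArg (fun k => CommaMorphism.left k ≫ pullback.snd _ _)
          (OverStar.isoPullback_hom_naturality (Over.forgetAdjStar P) (Over.forgetAdjStar Q) Lb pbK ιL hTL g)
        simp only [Over.comp_left, Category.assoc, OverStar.pullbackMap, Over.homMk_left,
          pullback.lift_snd] at hn
        simpa only [Category.assoc] using hn.symm)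
      Y Y' γ ((εV (φ.base.vertexMap v)).hom.left ≫ pullback.snd _ _)
      ((εE (ℋ.graph.edgeOf (φ.base.branchMap b)) f₀ p₀).hom.left ≫ pullback.snd _ _)
      (X.left.ψ (ψ.base.branchMap (φ.base.branchMap b)) (ψ.base.vertexMap (φ.base.vertexMap v))
        (ψ.base.abuts_branchMap _ _ h')).hom
      (by
        change (αf.inv.map _).left ≫ _ = _
        exact Hom.compGluing_pieces' ψ A αψ eψ (φ.base.branchMap b) (φ.base.vertexMap v) h' P αw ew Q αf ef
          (ιE _ _ _) (hιE _ _ _) X (hT _ _ _) (εV (φ.base.vertexMap v))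
          (OverStar.isoPullback_hom_comp (Over.forgetAdjStar A) (Over.forgetAdjStar P) _ _ _ _ X)
          (εB Y) (OverStar.isoPullback_hom_comp (Over.forgetAdjStar P) (Over.forgetAdjStar Q) Lb pbK ιL hTL Y)
          (εE (ℋ.graph.edgeOf (φ.base.branchMap b)) f₀ p₀)
          (OverStar.isoPullback_hom_comp (Over.forgetAdjStar A) (Over.forgetAdjStar Q) _ _ _ _ X))
      K L (uL.hom ≫ t' ≫ (ℋ.pull (φ.base.branchMap b) (φ.base.vertexMap v) h').pullback.map uK.inv)
      (by
        have hK : K.1.arrow = uK.hom ≫ (cVφ v).1.arrow ≫ (jV (φ.base.vertexMap v)).symm.hom :=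
          componentMapIso_arrow _ _
        have hL : L.1.arrow = uL.hom ≫ Lc.1.arrow ≫
            (jE (ℋ.graph.edgeOf (φ.base.branchMap b)) f₀ p₀).symm.hom := componentMapIso_arrow _ _
        rw [hK, hL, Functor.mapIso_hom, Functor.fun_inv_map]
        simp only [Iso.trans_hom, Functor.mapIso_hom, Iso.symm_hom,
          Functor.isoWhiskerLeft_inv, Functor.whiskerLeft_app, Functor.map_comp,
          Category.assoc]
        erw [Equivalence.counitIso_inv_hom_id_app_assoc]
        rw [Iso.map_inv_hom_id_assoc, Iso.map_inv_hom_id_assoc, reassoc_of% ht']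
        rfl)
    -- repack: the named component at the home edge of `𝒦`, then transport
    haveI := X.left.mono_map_arrow_comp_ψ (ψ.base.branchMap (φ.base.branchMap b))
      (ψ.base.vertexMap (φ.base.vertexMap v)) (ψ.base.abuts_branchMap _ _ h')
      (componentIn αw Y ((εV (φ.base.vertexMap v)).hom.left ≫ pullback.snd _ _) K).1
    have hle := Subobject.le_mk_of_comm s hs
    change (labE (ℋ.graph.edgeOf (φ.base.branchMap b)) f₀ p₀ Lc).1 ≤ _ at hle
    rw [hco (φ.base.edgeOf_branchMap b) p₀ (cEφ (𝒢.graph.edgeOf b))] at hle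
    exact X.left.exists_transport_of_fac_castT ((φ.comp ψ).base.edgeOf_branchMap b)
      (labE (φ.base.edgeMap (𝒢.graph.edgeOf b)) _ rfl (cEφ (𝒢.graph.edgeOf b))) _
      (Subobject.ofLEMk _ _ hle) (Subobject.ofLEMk_comp hle)

end SemiGraphOfAnabelioids

end Literature.AnabelianGeometry.SemiGraphs
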